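import Literature.NumberTheory.Automorphic.CDTTheorem712
import Literature.NumberTheory.EllipticCurves.ModFiveCongruenceHesseFamily
import Literature.NumberTheory.EllipticCurves.ModThreeReducibleIffPsi3Root
import Literature.NumberTheory.GaloisRepresentations.AbsGaloisGroup
import Literature.NumberTheory.GaloisRepresentations.ChebotarevOpenSubgroup
import Literature.NumberTheory.EllipticCurves.WeilPairingProofs
import Literature.NumberTheory.EllipticCurves.SzpiroOfAbcProofs
import Mathlib.NumberTheory.LSeries.PrimesInAP
import HarnessLib

/-!
# stub-ideation k3, generation 3 — `stub_switch` (= `CDT_three_five_switch`), NO hypothesis at `3`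

Generation 2 (`…StubSwitchK3g2`) proved the switch for `9 ∤ N_E` from ONE point of the
`j = 1728` fibre of `X_E(5) ≅ ℙ¹` read at ONE prime `ℓ ≡ 5 (mod 12)`, and carried the additive
slice `9 ∣ N_E, 27 ∤ N_E` of the typed stub as a residual (`AdditiveTameResidual`): its inertial
element `τ = τ₀⁵` had to act TRIVIALLY on `E[5]`, which fails exactly when `√-3 ∈ ℚ(E[5], i)`.

Generation 3 removes every hypothesis at `3` by TWISTING THE AUXILIARY CM CURVE instead of
restricting `E`:  with `τ₀` inertial at `3`, `χ̄₃(τ₀) = -1`, put `σ := τ₀¹⁵`.  Then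
`b := ρ̄_{E,5}(σ) = ρ̄_{E,5}(τ₀)¹⁵ ∈ SL₂(𝔽₅)` satisfies `b⁴ = 1` (exponent of `SL₂(𝔽₅) = 2I` is
`60`), so `b = 1`, `b = -1` or `b² = -1` — whatever the reduction type of `E` at `3` — and the
three `j = 1728` curves `E₁ : y² = x³ + x` (good at `3`), `E₉ : y² = x³ + 9x` (its twist by
`ℚ(√-3)`), `E₋₃ : y² = x³ − 3x` (its quartic twist, `u⁴ = -3`) realise exactly these three shapes:
`ρ̄_{E₁,5}(σ) = 1`, `ρ̄_{E₉,5}(σ) = -1`, `ρ̄_{E₋₃,5}(σ)² = -1`.  Since the order-`4` elements of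
`SL₂(𝔽₅)` form ONE conjugacy class (kernel-checked below), there is a symplectic `φ : E_D[5] ≅ E[5]`
with `φ ρ̄_{E_D}(σ) = ρ̄_E(σ) φ`; on `K := ℚ̄^H`, `H = {γ : φ ρ̄_{E_D}(γ) = ρ̄_E(γ) φ} ∋ σ`, this is
a direct `5`-congruence, so Fisher 13.2 (ii) over `K` gives `E_D ≅ E_{λ,μ}` with `λ, μ ∈ K`,
`𝔠₆(λ,μ) = 0`: a root `t₁ = λ/μ` of `𝔠₆(·,1)` FIXED BY `σ`.  From there generation 2's road is
unchanged (Chebotarev ⇒ `ℓ ≡ 5 (12)` and `t ≡ t₁`; `Ψ₃(E_t) ≡ 3x⁴ + 6āx² − ā²` irreducible;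
Fisher 13.2 (i); Rubin's Prop. 6), and the line proves the STRONGER uniform statement
`IrreduciblePsi3SourceAll`: every `E/ℚ` is `5`-congruent to some `E'/ℚ` with `Ψ₃(E')` irreducible.

`lean check`: every `sorry` sits inside a helper statement; the three finite `SL₂(𝔽₅)` lemmas are
PROVED (`decide +kernel`); the assembly helpers ⇒ `CDT_three_five_switch` is sorry-free.
-/

namespace Summit.ABC.ABC.Cruxes.FreyModularity.StubSwitchK3g3

open Literature.NumberTheory.EllipticCurves Literature.NumberTheory.EllipticCurves.HesseFamilyFive
open Literature.NumberTheory.Automorphic Literature.NumberTheory.GaloisRepresentations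
open Literature.NumberTheory.Automorphic.BCDT WeierstrassCurve Polynomial
open scoped IntermediateField

noncomputable section

/-! ## Part A — carried over verbatim from generation 2 (shared helpers G1–G3, G6, k2's helperB) -/


/-- Fisher's Hesse member `E_{l,m} : y² = x³ − 27𝔠₄(l,m)x − 54𝔠₆(l,m)` over `(c₄, c₆)`. -/
abbrev member (c₄ c₆ l m : ℚ) : WeierstrassCurve ℚ :=
  ⟨0, 0, 0, -27 * C4 c₄ c₆ l m, -54 * C6 c₄ c₆ l m⟩

/-- The `c₄c₆`-model `y² = x³ − 27c₄x − 54c₆` (= the member at `(l:m) = (1:0)`). -/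
abbrev base (c₄ c₆ : ℚ) : WeierstrassCurve ℚ := ⟨0, 0, 0, -27 * c₄, -54 * c₆⟩

/-- gen-1 H1 (PROVED there): transport of a framed `5`-torsion model along a `5`-congruence. -/
theorem isTorsionGaloisRep_of_congr {W W' : WeierstrassCurve ℚ} (h : Congr W' W)
    {ρ : ModPGaloisRep ℚ (ZMod 5) 2} (hρ : W.IsTorsionGaloisRep 5 ρ) :
    W'.IsTorsionGaloisRep 5 ρ := by
  obtain ⟨e', he'⟩ := h
  obtain ⟨e, he⟩ := hρ
  refine ⟨e'.trans e, fun σ P => ?_⟩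
  rw [AddEquiv.trans_apply, AddEquiv.trans_apply, he', he]

/-- k2's HB1 = Rubin 1997 Prop. 6 in polynomial form (sorried in k2's sketch, M/L; signature verbatim):
`Ψ₃` irreducible over `ℚ` ⇒ every framed `ρ̄_{E,3}` is abs. irreducible on `Γ_{ℚ(√-3)}`.  Finite
check behind it (folder `num/gl23.py`): among the 55 subgroups of `GL₂(𝔽₃)`, those with `det` onto,
a `det = −1` involution (complex conjugation) and transitive on `ℙ¹(𝔽₃)` are exactly `N_ns(3)` and
`GL₂(𝔽₃)`, whose intersections with `SL₂(𝔽₃)` (`Q₈`, `SL₂`) are non-abelian. -/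
theorem helperB_isAbsIrreducibleOverSqrt_of_irreducible_Ψ₃ (W : WeierstrassCurve ℚ) [W.IsElliptic]
    (hΨ : Irreducible W.Ψ₃) (ρ₃ : ModPGaloisRep ℚ (ZMod 3) 2) (hρ : W.IsTorsionGaloisRep 3 ρ₃) :
    ρ₃.IsAbsIrreducibleOverSqrt (-3) := by
  sorry



/-! ## G1 — the `j = 1728` fibre is `3`-irreducible modulo `ℓ ≡ 5 (12)` (S, pure algebra) -/

/-- G1a (S): `3X⁴ + 6āX² − ā²` is irreducible over `𝔽_ℓ`, `ℓ ≡ 5 (mod 12)`, `ā ≠ 0`.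
A root gives `(3x² + 3ā)² = 12ā²` so `3 ∈ 𝔽_ℓ²` — but `(3/ℓ) = −1`; a factor `3(X²+pX+q)(X²−pX+q')`
forces `p = 0 ∧ 16ā²/3 ∈ 𝔽_ℓ²` (again `3 ∈ 𝔽_ℓ²`) or `q = q' ∧ q² = −ā²/3` (`−3 ∈ 𝔽_ℓ²`, but
`ℓ ≡ 2 (3)`).  Checked by brute force for all `ℓ < 140` (folder `num/g1check.py`). -/
theorem irreducible_Ψ₃_shape_mod (ℓ : ℕ) [Fact ℓ.Prime] (h12 : ℓ % 12 = 5) (a : ZMod ℓ)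
    (ha : a ≠ 0) :
    Irreducible (C 3 * X ^ 4 + C (6 * a) * X ^ 2 - C (a ^ 2) : (ZMod ℓ)[X]) := by
  sorry

/-- G1 (M): lift to `ℚ`.  For `ℓ ≡ 5 (12)`, `a` an `ℓ`-unit and `ℓ ∣ b` (or `b = 0`),
`Ψ₃(y² = x³ + ax + b) = 3X⁴ + 6aX² + 12bX − a²` reduces to G1a's quartic, so it is irreducible over
`ℚ` (monic form `Y⁴ + 18aY² + 108bY − 27a²`, `Y = 3X`; Gauss + `Polynomial.Monic.irreducible_of_irreducible_map`). -/
theorem irreducible_Ψ₃_of_prime_five_mod_twelve (ℓ : ℕ) (hℓ : ℓ.Prime) (h12 : ℓ % 12 = 5)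
    (a b : ℚ) (ha : a ≠ 0) (hva : padicValRat ℓ a = 0) (hvb : b = 0 ∨ 0 < padicValRat ℓ b) :
    Irreducible (⟨0, 0, 0, a, b⟩ : WeierstrassCurve ℚ).Ψ₃ := by
  sorry

/-! ## G2 — bookkeeping: a Hesse member in the `1728`-fibre mod `ℓ` (S) -/

/-- G2 (S): `t ≡ t̄₁ (mod ℓ)` with `𝔠₆(t̄₁) = 0 ≠ 𝔠₄(t̄₁)` in `𝔽_ℓ`, `ℓ ∉ {2,3,5,11}` (the primes in
the denominators `17424 = 2⁴3²11²`, `240` of `C4`, `C6`): the member `E_{t,1}` has `a₄` an `ℓ`-unit,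
`ℓ ∣ a₆`, hence `Δ ≡ −64a₄³ ≢ 0`. -/
theorem member_fibre1728_mod (ℓ : ℕ) [Fact ℓ.Prime] (hℓ : ℓ ∉ ({2, 3, 5, 11} : Finset ℕ))
    (c₄ c₆ t : ℤ) (h6 : C6 (c₄ : ZMod ℓ) (c₆ : ZMod ℓ) (t : ZMod ℓ) 1 = 0)
    (h4 : C4 (c₄ : ZMod ℓ) (c₆ : ZMod ℓ) (t : ZMod ℓ) 1 ≠ 0) :
    (member c₄ c₆ t 1).a₄ ≠ 0 ∧ padicValRat ℓ (member c₄ c₆ t 1).a₄ = 0 ∧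
      ((member c₄ c₆ t 1).a₆ = 0 ∨ 0 < padicValRat ℓ (member c₄ c₆ t 1).a₆) ∧
      (member c₄ c₆ t 1).Δ ≠ 0 := by
  sorry

/-! ## G3 — Chebotarev: a fixed algebraic root of `𝔠₆` gives a prime `ℓ ≡ 5 (12)` and a root mod `ℓ` (M) -/

/-- G3 (M): `t₁ ∈ ℚ̄` a root of `𝔠₆(c₄,c₆;·,1)` off the cusps, `σ ∈ Γ_ℚ` fixing `t₁` and acting on
`μ₁₂` by `5`.  Chebotarev (tree, PROVED: `exists_isArithFrobAt_mul_inv_mem_not_mem` with `N` the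
pointwise stabiliser of the `Γ_ℚ`-orbit of `t₁` and of `ζ₁₂`) gives `ℓ ∉ S` and a Frobenius `φ` at
`𝔓 ∣ ℓ` in `σN`: `φ t₁ = t₁ ⇒ t₁ ≡ t̄ ∈ 𝔽_ℓ (mod 𝔓)` (`absIntegersResidue'`), `φ ζ₁₂ = ζ₁₂⁵ ⇒ ℓ ≡ 5 (12)`;
excluding the finitely many `ℓ` below `𝔠₄(t₁)𝔇(t₁)(c₄³ − c₆²)` keeps `𝔠₄(t̄) ≠ 0`. -/
theorem exists_prime_five_mod_twelve_root (c₄ c₆ : ℤ) (hc : c₄ ^ 3 ≠ c₆ ^ 2)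
    (t₁ ζ : AlgebraicClosure ℚ) (h6 : C6 (c₄ : AlgebraicClosure ℚ) c₆ t₁ 1 = 0)
    (hD : D (c₄ : AlgebraicClosure ℚ) c₆ t₁ 1 ≠ 0) (hζ : IsPrimitiveRoot ζ 12)
    (σ : Field.absoluteGaloisGroup ℚ) (hσt : σ • t₁ = t₁) (hσζ : σ • ζ = ζ ^ 5) (S : Finset ℕ) :
    ∃ (ℓ : ℕ) (_ : Fact ℓ.Prime), ℓ ∉ S ∧ ℓ % 12 = 5 ∧
      ∃ t : ℤ, C6 (c₄ : ZMod ℓ) (c₆ : ZMod ℓ) (t : ZMod ℓ) 1 = 0 ∧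
        C4 (c₄ : ZMod ℓ) (c₆ : ZMod ℓ) (t : ZMod ℓ) 1 ≠ 0 := by
  sorry


/-! ## Part B — the named fact (generation 2, unchanged): Fisher 13.2 (ii) over a subfield `K ⊆ ℚ̄` -/

/-- **NAMED FACT to vendor (PUB): Fisher 2012, Thm 13.2 (ii), `n = 5`**, specialised to curves
defined over `ℚ` and a subfield `K ⊆ ℚ̄` (`K` perfect, char `0`): if `E = (y² = x³ − 27c₄x − 54c₆)`
and `E'` are DIRECTLY `5`-congruent over `K` (a `Gal(ℚ̄/K)`-equivariant `E'[5] ≃ E[5]` respecting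
the Weil pairings `e₅`), then `E' ≅_{ℚ̄} E_{λ,μ}` for some `(λ, μ) ∈ K² ∖ 0`.  (Direction (i) is the
tree's `thm132_geomTorsionFive_of_hesseFamily`, whose docstring already flags (ii) as TODO.)
[Fisher2012Hessian, Thm 13.2 (ii) + Def. 13.1, arXiv:math/0610403 p.19; p.4: "perfect field K of
characteristic not dividing 6n".] -/
def Thm132iiMemHesseFamily : Prop :=
  ∀ (E E' : WeierstrassCurve ℚ) [E.IsElliptic] [E'.IsElliptic] (c₄ c₆ : ℚ)
    (K : IntermediateField ℚ (AlgebraicClosure ℚ)),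
    E = ⟨0, 0, 0, -27 * c₄, -54 * c₆⟩ →
    (∃ e : E'.geomTorsion 5 ≃+ E.geomTorsion 5,
      (∀ σ : Field.absoluteGaloisGroup ℚ, (∀ x : AlgebraicClosure ℚ, x ∈ K → σ • x = x) →
        ∀ P : E'.geomTorsion 5, e (σ • P) = σ • e P) ∧
      ∀ P Q : E'.geomTorsion 5,
        weilPairingFun (W := E) (m := 5) (by norm_num) (e P : E.geomPoints) (e Q) =
          weilPairingFun (W := E') (m := 5) (by norm_num) (P : E'.geomPoints) Q) →
    ∃ (l m : AlgebraicClosure ℚ), l ∈ K ∧ m ∈ K ∧ (l ≠ 0 ∨ m ≠ 0) ∧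
      ∃ Cv : VariableChange (AlgebraicClosure ℚ),
        Cv • E'.map (algebraMap ℚ (AlgebraicClosure ℚ)) =
          ⟨0, 0, 0, -27 * C4 (c₄ : AlgebraicClosure ℚ) c₆ l m, -54 * C6 (c₄ : AlgebraicClosure ℚ) c₆ l m⟩

/-! ## G6 — XS glue -/

/-- G6a (XS): an integral rescaling of `(c₄, c₆)`. -/
theorem exists_integral_scaling (x y : ℚ) :
    ∃ (u : ℤ) (c₄ c₆ : ℤ), u ≠ 0 ∧ (c₄ : ℚ) = (u : ℚ) ^ 4 * x ∧ (c₆ : ℚ) = (u : ℚ) ^ 6 * y := by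
  sorry

/-- G6b (XS): the rescaled `c₄c₆`-model is isomorphic (hence `5`-congruent, same conductor) to `W`
(`scale_smul_short`, `congr_fisherModel`, `conductorNorm_smul_rat`). -/
theorem base_scaled (W : WeierstrassCurve ℚ) [W.IsElliptic] {u c₄ c₆ : ℤ} (hu : u ≠ 0)
    (h4 : (c₄ : ℚ) = (u : ℚ) ^ 4 * W.c₄) (h6 : (c₆ : ℚ) = (u : ℚ) ^ 6 * W.c₆) :
    ∃ Cv : VariableChange ℚ, Cv • W = base c₄ c₆ := by
  sorry

/-- G6d (XS): an integer of absolute value `< ℓ` is an `ℓ`-unit. -/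
theorem padicValRat_eq_zero_of_natAbs_lt (ℓ : ℕ) (hℓ : ℓ.Prime) (z : ℤ) (hz : z ≠ 0)
    (hlt : z.natAbs < ℓ) : padicValRat ℓ (z : ℚ) = 0 := by
  sorry

/-- G6c (XS, Dirichlet in Mathlib: `Nat.forall_exists_prime_gt_and_eq_mod`). -/
theorem exists_prime_five_mod_twelve_gt (n : ℕ) : ∃ ℓ : ℕ, ℓ.Prime ∧ n < ℓ ∧ ℓ % 12 = 5 := by
  have h5 : IsUnit ((5 : ℕ) : ZMod 12) := by decide
  obtain ⟨ℓ, hgt, hp, hmod⟩ := Nat.forall_exists_prime_gt_and_eq_mod h5 n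
  refine ⟨ℓ, hp, hgt, ?_⟩
  have := (ZMod.natCast_eq_natCast_iff' ℓ 5 12).1 hmod
  simpa using this


/-! ## Part C — generation 3: the three `j = 1728` models and the inertial twist trichotomy -/

/-- `E₁ : y² = x³ + x` (`j = 1728`, conductor `64`, GOOD at `3`, `Δ = -64`). -/
abbrev E₁ : WeierstrassCurve ℚ := ⟨0, 0, 0, 1, 0⟩

/-- `E₉ : y² = x³ + 9x`, the quadratic twist of `E₁` by `ℚ(√-3)` (equivalently by `ℚ(√3)`):
`(x, y) ↦ (-3x, -3√-3·y)` maps `E₁ → E₉` over `ℚ(√-3)`. -/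
abbrev E₉ : WeierstrassCurve ℚ := ⟨0, 0, 0, 9, 0⟩

/-- `E₋₃ : y² = x³ − 3x`, the quartic twist of `E₁`: `(x, y) ↦ (u²x, u³y)`, `u⁴ = -3`. -/
abbrev Em₃ : WeierstrassCurve ℚ := ⟨0, 0, 0, -3, 0⟩

instance : E₁.IsElliptic :=
  ⟨isUnit_iff_ne_zero.mpr (by
    norm_num [E₁, WeierstrassCurve.Δ, WeierstrassCurve.b₂, WeierstrassCurve.b₄, WeierstrassCurve.b₆,
      WeierstrassCurve.b₈])⟩

instance : E₉.IsElliptic :=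
  ⟨isUnit_iff_ne_zero.mpr (by
    norm_num [E₉, WeierstrassCurve.Δ, WeierstrassCurve.b₂, WeierstrassCurve.b₄, WeierstrassCurve.b₆,
      WeierstrassCurve.b₈])⟩

instance : Em₃.IsElliptic :=
  ⟨isUnit_iff_ne_zero.mpr (by
    norm_num [Em₃, WeierstrassCurve.Δ, WeierstrassCurve.b₂, WeierstrassCurve.b₄, WeierstrassCurve.b₆,
      WeierstrassCurve.b₈])⟩

/-- T0 (M): **an inertial element at `3`.**  Some `τ₀ ∈ Γ_ℚ` negates `√-3`, fixes `μ₂₀` and acts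
trivially on `E₁[5]`.  Recipe over tree decls (all PROVED): `v ∋ 3`
(`RingOfIntegers.exists_heightOneSpectrum_natCast_mem`), `𝔓 ∈ v.primesAbove`
(`HeightOneSpectrum.primesAbove_nonempty`); `τ₀ ∈ 𝔓.inertia Γ_ℚ` with `τ₀ √3 = -√3`
(`exists_mem_inertia_smul_eq_neg_of_sq_eq_prime Nat.prime_three`); `χ_{20}(τ₀) = 1`
(`modNCyclotomicCharacter_eq_one_of_mem_inertia` with `20 ∉ 𝔓` from
`Rat.natCast_not_mem_of_mem_primesAbove_of_not_dvd`), whence `τ₀ z = z` for `z²⁰ = 1`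
(`modNCyclotomicCharacter_spec`), in particular `τ₀ i = i` and `τ₀ (± i√3) = ∓ i√3` (every `s`
with `s² = -3` is `± i√3`); `E₁ : y² = x³ + x` is integral with `Δ = -64` a `3`-unit, so it has
good reduction at `v` (`hasGoodReductionAt_of_valuation_Δ_eq_one_holds`) and `I_𝔓` acts trivially
on `E₁[5]` (`smul_geomTorsion_eq_of_mem_inertia`, Néron–Ogg–Shafarevich, `5 ∉ v`).  No hypothesis
on the curve `E` of the stub enters. -/
theorem exists_inertial_elt :
    ∃ τ₀ : Field.absoluteGaloisGroup ℚ,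
      (∀ s : AlgebraicClosure ℚ, s ^ 2 = -3 → τ₀ • s = -s) ∧
      (∀ z : AlgebraicClosure ℚ, z ^ 20 = 1 → τ₀ • z = z) ∧
      ∀ P : E₁.geomTorsion 5, τ₀ • P = P := by
  sorry

/-- T1 (M): **the quadratic twist on `5`-torsion.**  If `τ` negates `√-3` and acts trivially on
`E₁[5]`, it acts as `-1` on `E₉[5]`: `ψ(x,y) = (-3x, -3uy)`, `u² = -3`, is an isomorphism
`E₁ → E₉` over `ℚ̄` (`VariableChange.pointEquiv` on the base changes, `u⁻¹`-rescaling) with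
`τ(ψ P) = ψ(-(τ P))` because `τ u = -u`. -/
theorem smul_torsion_E₉ (τ : Field.absoluteGaloisGroup ℚ)
    (hs : ∀ s : AlgebraicClosure ℚ, s ^ 2 = -3 → τ • s = -s)
    (h₁ : ∀ P : E₁.geomTorsion 5, τ • P = P) :
    ∀ P : E₉.geomTorsion 5, τ • P = -P := by
  sorry

/-- T2 (M): **the quartic twist on `5`-torsion.**  If `τ` negates `√-3`, fixes `μ₄` and acts
trivially on `E₁[5]`, then `τ² = -1` on `E₋₃[5]`: `ψ(x,y) = (u²x, u³y)`, `u⁴ = -3`, maps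
`E₁ → E₋₃`; `τ u = ζu` with `ζ⁴ = 1` and `ζ² = τ(u²)/u² = -1` (`u²` is a square root of `-3`);
so `τ(ψP) = (-u²x, ζ³u³y)` and, `τ` fixing `ζ`, `τ²(ψP) = (u²x, ζ⁶u³y) = (u²x, -u³y) = -ψP`. -/
theorem smul_smul_torsion_Em₃ (τ : Field.absoluteGaloisGroup ℚ)
    (hs : ∀ s : AlgebraicClosure ℚ, s ^ 2 = -3 → τ • s = -s)
    (hi : ∀ z : AlgebraicClosure ℚ, z ^ 4 = 1 → τ • z = z)
    (h₁ : ∀ P : E₁.geomTorsion 5, τ • P = P) :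
    ∀ P : Em₃.geomTorsion 5, τ • (τ • P) = -P := by
  sorry

/-- T3 (PROVED): `τ ζ₁₂ = ζ₁₂⁵` for `τ` negating `√-3` and fixing `μ₄`:  `ω := ζ⁴` is a primitive cube
root with `(2ω + 1)² = -3`, so `τ ω = ω²`, i.e. `τ ζ⁴ = ζ⁸`; `τ ζ³ = ζ³`; `ζ = ζ⁴ · (ζ³)⁻¹`. -/
theorem smul_zeta12 (τ : Field.absoluteGaloisGroup ℚ)
    (hs : ∀ s : AlgebraicClosure ℚ, s ^ 2 = -3 → τ • s = -s)
    (hi : ∀ z : AlgebraicClosure ℚ, z ^ 4 = 1 → τ • z = z)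
    (ζ : AlgebraicClosure ℚ) (hζ : IsPrimitiveRoot ζ 12) : τ • ζ = ζ ^ 5 := by
  have h12 : ζ ^ 12 = 1 := hζ.pow_eq_one
  -- `ω := ζ⁴` is a primitive cube root of unity: `ω² + ω + 1 = 0`
  have hω1 : ζ ^ 4 ≠ 1 := fun h => by
    have := (hζ.pow_eq_one_iff_dvd 4).mp h
    omega
  have hquad : (ζ ^ 4) ^ 2 + ζ ^ 4 + 1 = 0 := by
    have h0 : (ζ ^ 4 - 1) * ((ζ ^ 4) ^ 2 + ζ ^ 4 + 1) = 0 := by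
      have : (ζ ^ 4) ^ 3 = 1 := by rw [← pow_mul]; exact h12
      linear_combination this
    exact (mul_eq_zero.mp h0).resolve_left (sub_ne_zero.mpr hω1)
  -- `s := 2ω + 1` has `s² = -3`, so `τ ω = ω²`
  have hsq : (ζ ^ 4 + ζ ^ 4 + 1) ^ 2 = -3 := by linear_combination 4 * hquad
  have H1 := hs _ hsq
  rw [smul_add, smul_add, smul_one] at H1
  have hτω : τ • ζ ^ 4 = (ζ ^ 4) ^ 2 := by
    linear_combination (1 / 2 : AlgebraicClosure ℚ) * H1 - hquad
  -- `ζ⁹ ∈ μ₄` is fixed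
  have hτ9 : τ • ζ ^ 9 = ζ ^ 9 := hi _ (by
    rw [← pow_mul, show 9 * 4 = 12 * 3 by norm_num, pow_mul, h12, one_pow])
  have hζ13 : ζ ^ 9 * ζ ^ 4 = ζ := by
    rw [← pow_add, show 9 + 4 = 12 + 1 by norm_num, pow_add, h12, one_mul, pow_one]
  calc τ • ζ = τ • (ζ ^ 9 * ζ ^ 4) := by rw [hζ13]
    _ = ζ ^ 9 * (ζ ^ 4) ^ 2 := by rw [smul_mul', hτ9, hτω]
    _ = ζ ^ 5 := by
        rw [← pow_mul, ← pow_add, show 9 + 4 * 2 = 12 + 5 by norm_num, pow_add, h12, one_mul]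

/-- XS: odd powers of `τ₀` keep T0's three properties. -/
theorem pow_odd_smul (τ : Field.absoluteGaloisGroup ℚ)
    (hs : ∀ s : AlgebraicClosure ℚ, s ^ 2 = -3 → τ • s = -s)
    (hz : ∀ z : AlgebraicClosure ℚ, z ^ 20 = 1 → τ • z = z)
    (h₁ : ∀ P : E₁.geomTorsion 5, τ • P = P) (n : ℕ) :
    (∀ s : AlgebraicClosure ℚ, s ^ 2 = -3 → (τ ^ (2 * n + 1)) • s = -s) ∧
    (∀ z : AlgebraicClosure ℚ, z ^ 20 = 1 → (τ ^ (2 * n + 1)) • z = z) ∧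
    ∀ P : E₁.geomTorsion 5, (τ ^ (2 * n + 1)) • P = P := by
  induction n with
  | zero => simp only [Nat.mul_zero, Nat.zero_add, pow_one]; exact ⟨hs, hz, h₁⟩
  | succ n ih =>
    obtain ⟨ihs, ihz, ih₁⟩ := ih
    have hpow : τ ^ (2 * (n + 1) + 1) = τ ^ (2 * n + 1) * (τ * τ) := by
      rw [show 2 * (n + 1) + 1 = (2 * n + 1) + 2 by ring, pow_add, pow_two]
    refine ⟨fun s hs2 => ?_, fun z hz20 => ?_, fun P => ?_⟩
    · rw [hpow, mul_smul, mul_smul, hs s hs2, smul_neg, hs s hs2, neg_neg, ihs s hs2]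
    · rw [hpow, mul_smul, mul_smul, hz z hz20, hz z hz20, ihz z hz20]
    · rw [hpow, mul_smul, mul_smul, h₁ P, h₁ P, ih₁ P]

/-! ## Part D — the finite group `SL₂(𝔽₅) = 2I` (PROVED, `decide +kernel`) and frame glue -/

/-- explicit `det = 1` on `2 × 2` matrices (keeps `Matrix.det`'s permutation sum out of the kernel). -/
abbrev det1 (A : Matrix (Fin 2) (Fin 2) (ZMod 5)) : Prop := A 0 0 * A 1 1 - A 0 1 * A 1 0 = 1

set_option maxHeartbeats 4000000 in
set_option maxRecDepth 100000 in
/-- F1 (PROVED): for `A ∈ SL₂(𝔽₅)`, `b := A¹⁵` is `1`, `-1`, or has `b² = -1` (the exponent of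
`SL₂(𝔽₅)` is `60`; its only involution is `-1`). [folklore] -/
theorem sl2f5_pow_fifteen_trichotomy :
    ∀ A : Matrix (Fin 2) (Fin 2) (ZMod 5), det1 A →
      (A ^ 15 = 1 ∨ A ^ 15 = -1 ∨ A ^ 15 * A ^ 15 = -1) := by
  decide +kernel

/-- `J = diag(2, 3) ∈ SL₂(𝔽₅)`, `J² = -1`. -/
abbrev J : Matrix (Fin 2) (Fin 2) (ZMod 5) := !![2, 0; 0, 3]

set_option maxHeartbeats 4000000 in
set_option maxRecDepth 100000 in
/-- F2 (PROVED): the `30` elements of order `4` of `SL₂(𝔽₅)` form ONE `SL₂(𝔽₅)`-conjugacy class: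
each is `SL₂`-conjugate to `J`, in both directions (`C A = J C` and `A C' = C' J`). [folklore] -/
theorem sl2f5_conj_J :
    ∀ A : Matrix (Fin 2) (Fin 2) (ZMod 5), det1 A → A * A = -1 →
      (∃ C : Matrix (Fin 2) (Fin 2) (ZMod 5), det1 C ∧ C * A = J * C) ∧
      (∃ C : Matrix (Fin 2) (Fin 2) (ZMod 5), det1 C ∧ A * C = C * J) := by
  decide +kernel

/-- bridge: `det g = 1` in `GL₂(𝔽₅)` is `det1` of the underlying matrix. -/
theorem det1_of_det_eq_one (g : GL (Fin 2) (ZMod 5)) (hg : Matrix.GeneralLinearGroup.det g = 1) :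
    det1 (g : Matrix (Fin 2) (Fin 2) (ZMod 5)) := by
  have h := congrArg Units.val hg
  rw [Matrix.GeneralLinearGroup.val_det_apply, Matrix.det_fin_two, Units.val_one] at h
  exact h

/-- F3 (PROVED, glue over F1): the trichotomy for `g ∈ GL₂(𝔽₅)` with `det g = 1`. -/
theorem gl_pow_fifteen_trichotomy (g : GL (Fin 2) (ZMod 5))
    (hg : Matrix.GeneralLinearGroup.det g = 1) :
    g ^ 15 = 1 ∨ g ^ 15 = -1 ∨ g ^ 15 * g ^ 15 = -1 := by
  rcases sl2f5_pow_fifteen_trichotomy _ (det1_of_det_eq_one g hg) with h | h | h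
  · exact Or.inl (Units.ext (by rw [Units.val_pow_eq_pow_val, h, Units.val_one]))
  · exact Or.inr (Or.inl (Units.ext (by
      rw [Units.val_pow_eq_pow_val, h, Units.val_neg, Units.val_one])))
  · exact Or.inr (Or.inr (Units.ext (by
      rw [Units.val_mul, Units.val_pow_eq_pow_val, h, Units.val_neg, Units.val_one])))

/-- F4 (PROVED, glue over F2 + the centraliser torus `diag(k, 1)` of `J`): two elements of
`GL₂(𝔽₅)` of determinant `1` squaring to `-1` are conjugate by a matrix of EVERY prescribed
determinant. -/
theorem gl_conj_of_sq_eq_neg_one (a b : GL (Fin 2) (ZMod 5))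
    (ha : Matrix.GeneralLinearGroup.det a = 1) (hb : Matrix.GeneralLinearGroup.det b = 1)
    (ha2 : a * a = -1) (hb2 : b * b = -1) (k : (ZMod 5)ˣ) :
    ∃ c : GL (Fin 2) (ZMod 5), Matrix.GeneralLinearGroup.det c = k ∧ c * a = b * c := by
  have hsq : ∀ g : GL (Fin 2) (ZMod 5), g * g = -1 →
      (g : Matrix (Fin 2) (Fin 2) (ZMod 5)) * g = -1 := fun g hg => by
    have h := congrArg Units.val hg
    rw [Units.val_mul, Units.val_neg, Units.val_one] at h
    exact h
  obtain ⟨⟨Ca, hCa, hCaJ⟩, -⟩ := sl2f5_conj_J _ (det1_of_det_eq_one a ha) (hsq a ha2)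
  obtain ⟨-, ⟨Cb, hCb, hCbJ⟩⟩ := sl2f5_conj_J _ (det1_of_det_eq_one b hb) (hsq b hb2)
  have hCa' : Matrix.det Ca ≠ 0 := by rw [Matrix.det_fin_two, hCa]; exact one_ne_zero
  have hCb' : Matrix.det Cb ≠ 0 := by rw [Matrix.det_fin_two, hCb]; exact one_ne_zero
  have hDk : Matrix.det (!![(k : ZMod 5), 0; 0, 1] : Matrix (Fin 2) (Fin 2) (ZMod 5)) = k := by
    rw [Matrix.det_fin_two]; simp
  have hDk' : Matrix.det (!![(k : ZMod 5), 0; 0, 1] : Matrix (Fin 2) (Fin 2) (ZMod 5)) ≠ 0 := by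
    rw [hDk]; exact k.ne_zero
  have hDkJ : (!![(k : ZMod 5), 0; 0, 1] : Matrix (Fin 2) (Fin 2) (ZMod 5)) * J =
      J * !![(k : ZMod 5), 0; 0, 1] := by
    ext i j; fin_cases i <;> fin_cases j <;> simp [Matrix.mul_apply, Fin.sum_univ_two, mul_comm]
  have hval : ∀ (A : Matrix (Fin 2) (Fin 2) (ZMod 5)) (h : Matrix.det A ≠ 0),
      ((Matrix.GeneralLinearGroup.mkOfDetNeZero A h : GL (Fin 2) (ZMod 5)) :
        Matrix (Fin 2) (Fin 2) (ZMod 5)) = A := fun A h => rfl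
  refine ⟨Matrix.GeneralLinearGroup.mkOfDetNeZero Cb hCb' *
      Matrix.GeneralLinearGroup.mkOfDetNeZero _ hDk' * Matrix.GeneralLinearGroup.mkOfDetNeZero Ca hCa',
    ?_, ?_⟩
  · apply Units.ext
    rw [map_mul, map_mul, Units.val_mul, Units.val_mul, Matrix.GeneralLinearGroup.val_det_apply,
      Matrix.GeneralLinearGroup.val_det_apply, Matrix.GeneralLinearGroup.val_det_apply, hval, hval,
      hval, hDk, Matrix.det_fin_two, Matrix.det_fin_two, hCa, hCb, one_mul, mul_one]
  · apply Units.ext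
    simp only [Units.val_mul, hval]
    set D : Matrix (Fin 2) (Fin 2) (ZMod 5) := !![(k : ZMod 5), 0; 0, 1] with hD
    calc Cb * D * Ca * (a : Matrix (Fin 2) (Fin 2) (ZMod 5))
        = Cb * D * (Ca * (a : Matrix (Fin 2) (Fin 2) (ZMod 5))) := by rw [Matrix.mul_assoc]
      _ = Cb * (D * J) * Ca := by rw [hCaJ, ← Matrix.mul_assoc, Matrix.mul_assoc Cb]
      _ = (b : Matrix (Fin 2) (Fin 2) (ZMod 5)) * Cb * D * Ca := by
          rw [hDkJ, ← Matrix.mul_assoc, ← hCbJ]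
      _ = (b : Matrix (Fin 2) (Fin 2) (ZMod 5)) * (Cb * D * Ca) := by simp only [Matrix.mul_assoc]

/-- XS (PROVED): `GL₂(𝔽₅)` has elements of every determinant (`det_surjective`). -/
theorem exists_gl_det_eq (k : (ZMod 5)ˣ) :
    ∃ c : GL (Fin 2) (ZMod 5), Matrix.GeneralLinearGroup.det c = k :=
  Matrix.GeneralLinearGroup.det_surjective k

/-- G0a (PROVED): a frame reads "`τ` acts trivially on `E[5]`" as `ρ̄(τ) = 1`. -/
theorem frame_eq_one {W : WeierstrassCurve ℚ} {ρ : ModPGaloisRep ℚ (ZMod 5) 2}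
    (hρ : W.IsTorsionGaloisRep 5 ρ) {τ : Field.absoluteGaloisGroup ℚ}
    (h : ∀ P : W.geomTorsion 5, τ • P = P) : ρ τ = 1 := by
  obtain ⟨e, he⟩ := hρ
  apply Units.ext
  rw [Units.val_one]
  refine Matrix.ext_iff_mulVec.mpr fun v => ?_
  obtain ⟨P, rfl⟩ := e.surjective v
  rw [← he, h, Matrix.one_mulVec]

/-- G0b (PROVED): "`τ` acts as `-1` on `E[5]`" reads `ρ̄(τ) = -1`. -/
theorem frame_eq_neg_one {W : WeierstrassCurve ℚ} {ρ : ModPGaloisRep ℚ (ZMod 5) 2}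
    (hρ : W.IsTorsionGaloisRep 5 ρ) {τ : Field.absoluteGaloisGroup ℚ}
    (h : ∀ P : W.geomTorsion 5, τ • P = -P) : ρ τ = -1 := by
  obtain ⟨e, he⟩ := hρ
  apply Units.ext
  rw [Units.val_neg, Units.val_one]
  refine Matrix.ext_iff_mulVec.mpr fun v => ?_
  obtain ⟨P, rfl⟩ := e.surjective v
  rw [← he, h, map_neg, Matrix.neg_mulVec, Matrix.one_mulVec]

/-- G0c (PROVED): "`τ² = -1` on `E[5]`" reads `ρ̄(τ)² = -1`. -/
theorem frame_sq_eq_neg_one {W : WeierstrassCurve ℚ} {ρ : ModPGaloisRep ℚ (ZMod 5) 2}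
    (hρ : W.IsTorsionGaloisRep 5 ρ) {τ : Field.absoluteGaloisGroup ℚ}
    (h : ∀ P : W.geomTorsion 5, τ • (τ • P) = -P) : ρ τ * ρ τ = -1 := by
  obtain ⟨e, he⟩ := hρ
  apply Units.ext
  rw [Units.val_mul, Units.val_neg, Units.val_one]
  refine Matrix.ext_iff_mulVec.mpr fun v => ?_
  obtain ⟨P, rfl⟩ := e.surjective v
  rw [← Matrix.mulVec_mulVec, ← he, ← he, h, map_neg, Matrix.neg_mulVec, Matrix.one_mulVec]

/-- G0d (PROVED): `det ρ̄_{E,5}(τ) = χ̄₅(τ) = 1` when `τ` fixes `μ₅` (tree, PROVED: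
`det_eq_modPCyclotomicCharacter_of_isTorsionGaloisRep_holds`, `modPCyclotomicCharacterZMod_spec`). -/
theorem det_frame_eq_one {W : WeierstrassCurve ℚ} [W.IsElliptic] {ρ : ModPGaloisRep ℚ (ZMod 5) 2}
    (hρ : W.IsTorsionGaloisRep 5 ρ) {τ : Field.absoluteGaloisGroup ℚ}
    (h5 : ∀ z : AlgebraicClosure ℚ, z ^ 5 = 1 → τ • z = z) :
    Matrix.GeneralLinearGroup.det (ρ τ) = 1 := by
  rw [W.det_eq_modPCyclotomicCharacter_of_isTorsionGaloisRep_holds 5 ρ hρ τ]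
  obtain ⟨ζ, hζ⟩ := HasEnoughRootsOfUnity.exists_primitiveRoot (AlgebraicClosure ℚ) 5
  refine modPCyclotomicCharacterZMod_eq_one_of_mem_fixingSubgroup ℚ 5 hζ τ ?_
  -- bridge to the `AlgEquiv` API (`Field.absoluteGaloisGroup` is a non-reducible `def`)
  set τ' : AlgebraicClosure ℚ ≃ₐ[ℚ] AlgebraicClosure ℚ := Field.absoluteGaloisGroup.toAlgEquiv ℚ τ
    with hτ'
  have h5' : τ' • ζ = ζ := h5 ζ hζ.pow_eq_one
  have hle : ℚ⟮ζ⟯ ≤ IntermediateField.fixedField (Subgroup.zpowers τ') := by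
    rw [IntermediateField.adjoin_simple_le_iff, IntermediateField.mem_fixedField_iff]
    intro f hf
    exact MulAction.mem_stabilizer_iff.mp
      ((Subgroup.zpowers_le.mpr (MulAction.mem_stabilizer_iff.mpr h5')) hf)
  exact (IntermediateField.le_iff_le _ _).mp hle (Subgroup.mem_zpowers τ')

/-! ## Part E — the `1728`-fibre has a `σ`-fixed point (the ONE consumer of the named fact) -/

/-- G4″ (L; splits as frames→`AddEquiv` (M) + closed-subgroup Galois correspondence (S) + named
fact + `c₆ = 0 ⇒ 𝔠₆(λ,μ) = 0` (S)): let `E = base c₄ c₆` (`c₆ ≠ 0`), `E'` elliptic with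
`c₆(E') = 0` (`j = 1728`), frames `ρ̄, ρ̄'` of `E[5], E'[5]`, and `σ ∈ Γ_ℚ` such that `ρ̄'(σ)` and
`ρ̄(σ)` are conjugate by matrices of every determinant.  Then some root `t₁ ∈ ℚ̄` of `𝔠₆(·, 1)`,
off the cusps, is FIXED BY `σ`.  Proof: pick `C` with `C ρ̄'(σ) C⁻¹ = ρ̄(σ)` and `det C` the
ratio of the two Weil-pairing generators in the frames (so `φ := e⁻¹ ∘ C ∘ e'` is symplectic);
`H := {γ : C ρ̄'(γ) = ρ̄(γ) C}` is a closed (indeed open) subgroup containing `σ`, `K := ℚ̄^H`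
(`IntermediateField.fixedField`, `fixingSubgroup_fixedField` for closed subgroups); `φ` is a direct
`5`-congruence over `K`, so `Thm132iiMemHesseFamily` gives `E' ≅ E_{λ,μ}`, `λ, μ ∈ K`;
`c₆(E') = 0 ⇒ 𝔠₆(λ,μ) = 0` (`variableChange_c₆`), `μ ≠ 0` (else `λ³⁰c₆ = 0`), `𝔇(λ,μ) ≠ 0`
(syzygy + `Δ ≠ 0`); `t₁ := λ/μ ∈ K` is fixed by `σ ∈ H`. -/
theorem exists_root_C6_fixed_of_conj (hFii : Thm132iiMemHesseFamily) (c₄ c₆ : ℤ)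
    (hc : c₄ ^ 3 ≠ c₆ ^ 2) (h6 : c₆ ≠ 0) [(base (c₄ : ℚ) c₆).IsElliptic]
    (E' : WeierstrassCurve ℚ) [E'.IsElliptic] (hj : E'.c₆ = 0)
    (ρ ρ' : ModPGaloisRep ℚ (ZMod 5) 2) (hρ : (base (c₄ : ℚ) c₆).IsTorsionGaloisRep 5 ρ)
    (hρ' : E'.IsTorsionGaloisRep 5 ρ') (σ : Field.absoluteGaloisGroup ℚ)
    (hconj : ∀ k : (ZMod 5)ˣ, ∃ C : GL (Fin 2) (ZMod 5),
      Matrix.GeneralLinearGroup.det C = k ∧ C * ρ' σ = ρ σ * C) :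
    ∃ t₁ : AlgebraicClosure ℚ, C6 (c₄ : AlgebraicClosure ℚ) c₆ t₁ 1 = 0 ∧
      D (c₄ : AlgebraicClosure ℚ) c₆ t₁ 1 ≠ 0 ∧ σ • t₁ = t₁ := by
  sorry

/-! ## Assembly (sorry-free modulo the helpers): NO hypothesis at `3` -/

/-- **The gen-3 core (PROVED from T0–T3, F1–F4, G0, G4″).**  For every integral `c₄c₆`-model with
`c₆ ≠ 0` there are `τ ∈ Γ_ℚ` negating `√-3` and fixing `μ₄`, and a root `t₁` of `𝔠₆(·,1)` off the
cusps with `τ t₁ = t₁`. -/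
theorem exists_fixed_root_1728 (hFii : Thm132iiMemHesseFamily) (c₄ c₆ : ℤ)
    (hc : c₄ ^ 3 ≠ c₆ ^ 2) (h6 : c₆ ≠ 0) [(base (c₄ : ℚ) c₆).IsElliptic] :
    ∃ (τ : Field.absoluteGaloisGroup ℚ) (t₁ : AlgebraicClosure ℚ),
      (∀ s : AlgebraicClosure ℚ, s ^ 2 = -3 → τ • s = -s) ∧
      (∀ z : AlgebraicClosure ℚ, z ^ 4 = 1 → τ • z = z) ∧
      C6 (c₄ : AlgebraicClosure ℚ) c₆ t₁ 1 = 0 ∧ D (c₄ : AlgebraicClosure ℚ) c₆ t₁ 1 ≠ 0 ∧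
      τ • t₁ = t₁ := by
  obtain ⟨τ₀, hs₀, hz₀, h₁₀⟩ := exists_inertial_elt
  obtain ⟨hs, hz, h₁⟩ := pow_odd_smul τ₀ hs₀ hz₀ h₁₀ 7
  have hi : ∀ z : AlgebraicClosure ℚ, z ^ 4 = 1 → (τ₀ ^ (2 * 7 + 1)) • z = z := fun z hz4 =>
    hz z (by rw [show (20 : ℕ) = 4 * 5 by norm_num, pow_mul, hz4, one_pow])
  have h5 : ∀ z : AlgebraicClosure ℚ, z ^ 5 = 1 → (τ₀ ^ (2 * 7 + 1)) • z = z := fun z hz5 =>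
    hz z (by rw [show (20 : ℕ) = 5 * 4 by norm_num, pow_mul, hz5, one_pow])
  have h5₀ : ∀ z : AlgebraicClosure ℚ, z ^ 5 = 1 → τ₀ • z = z := fun z hz5 =>
    hz₀ z (by rw [show (20 : ℕ) = 5 * 4 by norm_num, pow_mul, hz5, one_pow])
  -- frames and the trichotomy for `b = ρ̄_E(τ₀)¹⁵`
  obtain ⟨ρ, hρ⟩ := (base (c₄ : ℚ) c₆).exists_isTorsionGaloisRep 5
  have hdet₀ : Matrix.GeneralLinearGroup.det (ρ τ₀) = 1 := det_frame_eq_one hρ h5₀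
  have hρτ : ρ (τ₀ ^ (2 * 7 + 1)) = (ρ τ₀) ^ 15 := by rw [map_pow]
  have hdetτ : Matrix.GeneralLinearGroup.det (ρ (τ₀ ^ (2 * 7 + 1))) = 1 := det_frame_eq_one hρ h5
  -- the auxiliary `j = 1728` curve matching the shape of `b`
  have haux : ∃ (E' : WeierstrassCurve ℚ) (_ : E'.IsElliptic) (ρ' : ModPGaloisRep ℚ (ZMod 5) 2),
      E'.c₆ = 0 ∧ E'.IsTorsionGaloisRep 5 ρ' ∧
      ∀ k : (ZMod 5)ˣ, ∃ C : GL (Fin 2) (ZMod 5),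
        Matrix.GeneralLinearGroup.det C = k ∧ C * ρ' (τ₀ ^ (2 * 7 + 1)) = ρ (τ₀ ^ (2 * 7 + 1)) * C := by
    rcases gl_pow_fifteen_trichotomy (ρ τ₀) hdet₀ with hb | hb | hb
    · -- `b = 1`: `E' = E₁`, on whose `5`-torsion `τ` acts trivially
      obtain ⟨ρ', hρ'⟩ := E₁.exists_isTorsionGaloisRep 5
      refine ⟨E₁, inferInstance, ρ', by norm_num [E₁, WeierstrassCurve.c₆, WeierstrassCurve.b₂,
        WeierstrassCurve.b₄, WeierstrassCurve.b₆], hρ', fun k => ?_⟩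
      obtain ⟨C, hC⟩ := exists_gl_det_eq k
      refine ⟨C, hC, ?_⟩
      rw [frame_eq_one hρ' h₁, hρτ, hb, mul_one, one_mul]
    · -- `b = -1`: `E' = E₉`, on whose `5`-torsion `τ` acts as `-1`
      obtain ⟨ρ', hρ'⟩ := E₉.exists_isTorsionGaloisRep 5
      refine ⟨E₉, inferInstance, ρ', by norm_num [E₉, WeierstrassCurve.c₆, WeierstrassCurve.b₂,
        WeierstrassCurve.b₄, WeierstrassCurve.b₆], hρ', fun k => ?_⟩
      obtain ⟨C, hC⟩ := exists_gl_det_eq k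
      refine ⟨C, hC, ?_⟩
      rw [frame_eq_neg_one hρ' (smul_torsion_E₉ _ hs h₁), hρτ, hb, mul_neg_one, neg_one_mul]
    · -- `b² = -1`: `E' = E₋₃`, on whose `5`-torsion `τ² = -1`; one conjugacy class
      obtain ⟨ρ', hρ'⟩ := Em₃.exists_isTorsionGaloisRep 5
      refine ⟨Em₃, inferInstance, ρ', by norm_num [Em₃, WeierstrassCurve.c₆, WeierstrassCurve.b₂,
        WeierstrassCurve.b₄, WeierstrassCurve.b₆], hρ', fun k => ?_⟩
      have hsq' : ρ' (τ₀ ^ (2 * 7 + 1)) * ρ' (τ₀ ^ (2 * 7 + 1)) = -1 :=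
        frame_sq_eq_neg_one hρ' (smul_smul_torsion_Em₃ _ hs hi h₁)
      have hdet' : Matrix.GeneralLinearGroup.det (ρ' (τ₀ ^ (2 * 7 + 1))) = 1 :=
        det_frame_eq_one hρ' h5
      have hsq : ρ (τ₀ ^ (2 * 7 + 1)) * ρ (τ₀ ^ (2 * 7 + 1)) = -1 := by rw [hρτ, hb]
      exact gl_conj_of_sq_eq_neg_one _ _ hdet' hdetτ hsq' hsq k
  obtain ⟨E', hE', ρ', hj, hρ', hconj⟩ := haux
  obtain ⟨t₁, ht6, htD, hfix⟩ :=
    exists_root_C6_fixed_of_conj hFii c₄ c₆ hc h6 E' hj ρ ρ' hρ hρ' (τ₀ ^ (2 * 7 + 1)) hconj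
  exact ⟨τ₀ ^ (2 * 7 + 1), t₁, hs, hi, ht6, htD, hfix⟩

/-- every `E/ℚ` — no hypothesis at `3` — is `5`-congruent to an `E'/ℚ` with `Ψ₃(E')` irreducible. -/
def IrreduciblePsi3SourceAll : Prop :=
  ∀ (W : WeierstrassCurve ℚ) [W.IsElliptic],
    ∃ (W' : WeierstrassCurve ℚ) (_ : W'.IsElliptic), Congr W' W ∧ Irreducible W'.Ψ₃

theorem irreduciblePsi3SourceAll_of_helpers (hF : thm132_geomTorsionFive_of_hesseFamily)
    (hFii : Thm132iiMemHesseFamily) : IrreduciblePsi3SourceAll := by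
  intro W _
  -- integral `c₄c₆`-model
  obtain ⟨u, c₄, c₆, hu, h4, h6⟩ := exists_integral_scaling W.c₄ W.c₆
  obtain ⟨Cv, hCv⟩ := base_scaled W hu h4 h6
  haveI hBell : (base (c₄ : ℚ) c₆).IsElliptic := by rw [← hCv]; infer_instance
  have hcongrB : Congr (base (c₄ : ℚ) c₆) W := congr_symm (congr_of_smul_eq Cv hCv)
  have hcQ : (c₄ : ℚ) ^ 3 ≠ (c₆ : ℚ) ^ 2 := by
    intro h
    have h1728 : (1728 : ℚ) * (base (c₄ : ℚ) c₆).Δ = (base (c₄ : ℚ) c₆).c₄ ^ 3 - (base (c₄ : ℚ) c₆).c₆ ^ 2 :=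
      (base (c₄ : ℚ) c₆).c_relation
    have hc4 : (base (c₄ : ℚ) c₆).c₄ = 6 ^ 4 * c₄ := by
      simp only [WeierstrassCurve.c₄, WeierstrassCurve.b₂, WeierstrassCurve.b₄]; ring
    have hc6 : (base (c₄ : ℚ) c₆).c₆ = 6 ^ 6 * c₆ := by
      simp only [WeierstrassCurve.c₆, WeierstrassCurve.b₂, WeierstrassCurve.b₄, WeierstrassCurve.b₆]; ring
    rw [hc4, hc6, mul_pow, mul_pow, h, show ((6 : ℚ) ^ 4) ^ 3 = (6 ^ 6) ^ 2 by norm_num, ← sub_mul,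
      sub_self, zero_mul] at h1728
    exact (base (c₄ : ℚ) c₆).isUnit_Δ.ne_zero (by simpa using h1728)
  have hc : c₄ ^ 3 ≠ c₆ ^ 2 := fun h => hcQ (by exact_mod_cast h)
  by_cases hc₆ : c₆ = 0
  · -- `j = 1728`: `W' := base c₄ 0` itself; any prime `ℓ ≡ 5 (12)` above `|27 c₄|` works
    subst hc₆
    have hc₄ : c₄ ≠ 0 := by rintro rfl; exact hc (by norm_num)
    have hz : (-27 * c₄ : ℤ) ≠ 0 := by omega
    obtain ⟨ℓ, hℓ, hgt, h12⟩ := exists_prime_five_mod_twelve_gt (-27 * c₄).natAbs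
    have ha : (-27 * (c₄ : ℚ)) ≠ 0 := by exact_mod_cast hz
    have hva : padicValRat ℓ (-27 * (c₄ : ℚ)) = 0 := by
      have := padicValRat_eq_zero_of_natAbs_lt ℓ hℓ (-27 * c₄) hz hgt
      exact_mod_cast this
    refine ⟨base (c₄ : ℚ) ((0 : ℤ) : ℚ), hBell, hcongrB, ?_⟩
    exact irreducible_Ψ₃_of_prime_five_mod_twelve ℓ hℓ h12 (-27 * (c₄ : ℚ)) (-54 * ((0 : ℤ) : ℚ))
      ha hva (Or.inl (by simp))
  · -- generic case: the TWISTED `1728`-fibre road (gen 3 — no hypothesis at `3`)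
    obtain ⟨τ, t₁, hs, hi, ht6, htD, hfix⟩ := exists_fixed_root_1728 hFii c₄ c₆ hc hc₆
    obtain ⟨ζ, hζ⟩ := HasEnoughRootsOfUnity.exists_primitiveRoot (AlgebraicClosure ℚ) 12
    have hτζ : τ • ζ = ζ ^ 5 := smul_zeta12 τ hs hi ζ hζ
    obtain ⟨ℓ, hℓF, hℓS, h12, t, ht6', ht4'⟩ :=
      exists_prime_five_mod_twelve_root c₄ c₆ hc t₁ ζ ht6 htD hζ τ hfix hτζ {2, 3, 5, 11}
    obtain ⟨ha, hva, hvb, hΔ⟩ := member_fibre1728_mod ℓ hℓS c₄ c₆ t ht6' ht4'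
    set E' : WeierstrassCurve ℚ := member c₄ c₆ t 1 with hE'
    haveI hE'ell : E'.IsElliptic := ⟨isUnit_iff_ne_zero.mpr hΔ⟩
    have hirr : Irreducible E'.Ψ₃ :=
      irreducible_Ψ₃_of_prime_five_mod_twelve ℓ hℓF.out h12 E'.a₄ E'.a₆ ha hva hvb
    obtain ⟨e, he⟩ := hF (base (c₄ : ℚ) c₆) E' (c₄ : ℚ) (c₆ : ℚ) (t : ℚ) 1 rfl rfl
    exact ⟨E', hE'ell, congr_trans ⟨e, he⟩ hcongrB, hirr⟩

/-- **The line (gen 3).**  Fisher 13.2 (i) (tree fact) + Fisher 13.2 (ii) (to vendor) + the helpers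
⇒ `stub_switch` = `CDT_three_five_switch` OUTRIGHT: the hypotheses `27 ∤ N`, "no `ρ̄₃` abs.
irreducible", "`ρ̄` abs. irreducible" are never used — no residual slice. -/
theorem stub_switch_of_helpers (hF : thm132_geomTorsionFive_of_hesseFamily)
    (hFii : Thm132iiMemHesseFamily) : CDT_three_five_switch := by
  intro W _ _ _ ρ hρ _
  obtain ⟨W', hW', hc, hirr⟩ := irreduciblePsi3SourceAll_of_helpers hF hFii W
  haveI := hW'
  obtain ⟨ρ₃, hρ₃⟩ := W'.exists_isTorsionGaloisRep 3
  exact ⟨W', hW', isTorsionGaloisRep_of_congr hc hρ, ρ₃, hρ₃,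
    helperB_isAbsIrreducibleOverSqrt_of_irreducible_Ψ₃ W' hirr ρ₃ hρ₃⟩

/-- sanity: the stub is literally the route's named fact. -/
example : CDT_three_five_switch ↔
    (∀ (W : WeierstrassCurve ℚ) [W.IsElliptic], ¬ 27 ∣ W.conductorNorm ℤ →
      (∀ ρ₃ : ModPGaloisRep ℚ (ZMod 3) 2, W.IsTorsionGaloisRep 3 ρ₃ → ¬ ρ₃.IsAbsIrreducibleOverSqrt (-3)) →
      ∀ (ρ : ModPGaloisRep ℚ (ZMod 5) 2), W.IsTorsionGaloisRep 5 ρ → ρ.IsAbsIrreducibleOverSqrt 5 →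
        ∃ (W' : WeierstrassCurve ℚ) (_ : W'.IsElliptic), W'.IsTorsionGaloisRep 5 ρ ∧
          ∃ ρ₃' : ModPGaloisRep ℚ (ZMod 3) 2, W'.IsTorsionGaloisRep 3 ρ₃' ∧
            ρ₃'.IsAbsIrreducibleOverSqrt (-3)) := Iff.rfl

end

end Summit.ABC.ABC.Cruxes.FreyModularity.StubSwitchK3g3
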